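import Mathlib
import Summits.QuantumFields.QCD.Theses.PauliWegnerSea
import Literature.MathematicalPhysics.QuantumFieldTheory.QCDHeavyQuarkPropagator
import Literature.MathematicalPhysics.QuantumFieldTheory.QCDWickMinorMeasurability
import Literature.MathematicalPhysics.QuantumFieldTheory.QCDPhaseQuenchedPositivity

/-!
# The crux `PhaseQuenchedFlavourDecay` forces its reg-free UNIFORM pencil form
(crux `Summit.QuantumFields.QCD.Theses.PauliWegnerSea.PhaseQuenchedFlavourDecay`, item stmt-QuantumFields-9151,
line `crossing-split-integrability`, registered additive stub `stub_uniformPencil_of_crux`)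

`QCDRegularisation Nf` pins only `a_k > 0`, `a_k → 0`, `a_k L_k → ∞`, `Z_m(k) > 0`; the couplings `β_k`,
the critical masses `m_crit(k)` and the ratios `λ_k = a_k / Z_m(k) > 0` are free, so a regularisation can
VISIT any sequence of lattice parameter points `(β, c, λ)` with bare masses on the pencil `c + λ m`.
Hence the crux (Fredenhagen–Marcu decay `Upper` along a regularisation ⟹ a rate `δ' > 0` and, for every
flavour-charged pair of observables `(A, B)`, a constant `C'` with eventually
`|⟨A(0) B(n e₀)⟩| ≤ C' e^{-δ' a_k n}`) forces constants that are UNIFORM over all parameter points sharing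
the Fredenhagen–Marcu data `(s, C)`:

* `uniformPencilConc_diagonal` — the diagonal argument with the Fredenhagen–Marcu functional `FM`, the
  charge predicate `Ch` and the correlator size `K` kept OPAQUE.  If the uniform form fails, then for
  every rate `θ > 0` there is a charged pair `(R, R', A, B)(θ)` such that for all blocks
  `(Φ, μ₀, Λ₀) = (b, 1/(b+1), b)` there is a bad point; enumerate the bad points `P(j, b)`
  (`θ_j = 1/(j+1)`) along `k ↦ ((unpair k).1, k)` and assemble them into ONE regularisation
  (`a_k := μ ≤ 1/(k+1) → 0`, `a_k L_k ≥ k → ∞`, `Z_m := a_k/λ`).  The crux gives `δ'` and, for the pair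
  chosen at `θ_{j₀} ≤ δ'`, a constant `C'` valid for all late `k`; at a late `k` on the fibre
  `(unpair k).1 = j₀` with `k > C'` the bad point contradicts the elementary monotone transfer
  `C' e^{-δ' a n} ≤ k e^{-θ_{j₀} a n}`.
* `stub_uniformPencil_of_crux` — the REGISTERED signature, by instantiating `FM`, `Ch`, `K`.

Pure logic / filters over the tree's objects; no localisation or decay is claimed.
-/

noncomputable section

namespace Summit.QuantumFields.QCD.Cruxes.PhaseQuenchedFlavourDecay.CrossingSplitIntegrability

open scoped BigOperators
open MeasureTheory Filter
open Literature.MathematicalPhysics.QuantumFieldTheory Literature.MathematicalPhysics.QuantumLattice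
  Literature.Probability.LatticeModels

/-! ### The diagonal argument (opaque `FM`, charge predicate `Ch`, correlator size `K`) -/

/-- **Diagonal argument.** `FM β mq S f v` (the Fredenhagen–Marcu quotient at exponent `s`), the charge
predicate `Ch R A` and the correlator size `K β mq S R R' A B n` (the modulus of the phase-quenched
two-point function of `A(0)`, `B(n e₀)` on the torus of side `2S+1`) are arbitrary.  If the crux holds
along EVERY `QCDRegularisation` with `Upper`-data `(s, δ = 1, C)`, then its constants are uniform over the
pencil `c + λ m` of bare masses, the couplings `β`, and all rates `μ ≤ μ₀`, volumes `μ L ≥ Λ₀`: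
`K ≤ Φ e^{-θ μ n}`.  Proof by contradiction: the bad points `P(j, b)` (`θ_j = 1/(j+1)`, block
`(Φ, μ₀, Λ₀) = (b, 1/(b+1), b)`) visited along `k ↦ ((unpair k).1, k)` form an admissible regularisation
(`a_k = μ ≤ 1/(k+1)`, `a_k L_k ≥ k`, `Z_m = a_k/λ`, bare masses `c + a_k m / (a_k/λ) = c + λ m`); the crux's
`δ'`, its `C'` for the pair chosen at `θ_{j⋆} ≤ δ'`, and a late `k = pair j⋆ t` with `k > C'` contradict
badness via `C' e^{-δ' (a n)} ≤ k e^{-θ_{j⋆} a n}`. -/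
theorem uniformPencilConc_diagonal {Nf : ℕ} (m : Fin Nf → ℝ)
    (FM : ℝ → (Fin Nf → ℝ) → ℕ → Fin Nf → Literature.Probability.LatticeModels.Site 4 → ℝ)
    (Ch : ∀ R : ℕ, QCDLatticeObservable Nf R → Prop)
    (K : ∀ (β : ℝ) (mq : Fin Nf → ℝ) (S R R' : ℕ), QCDLatticeObservable Nf R →
      QCDLatticeObservable Nf R' → ℕ → ℝ) (C : ℝ)
    (hcrux : ∀ reg : QCDRegularisation Nf,
      (∀ᶠ k in atTop, ∀ S : ℕ, reg.L k ≤ S →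
        ∀ (f : Fin Nf) (v : Literature.Probability.LatticeModels.Site 4), v ∈ box 4 S →
        FM (reg.β k) (fun fl => reg.mcrit k + reg.a k * m fl / reg.Zm k) S f v ≤
          C * Real.exp (-(1 * (reg.a k * ‖v‖)))) →
      ∃ δ' : ℝ, 0 < δ' ∧ ∀ (R R' : ℕ) (A : QCDLatticeObservable Nf R) (B : QCDLatticeObservable Nf R'),
        Ch R A → ∃ C' : ℝ, ∀ᶠ k in atTop, ∀ S : ℕ, reg.L k ≤ S → ∀ n : ℕ, n ≤ S →
          K (reg.β k) (fun fl => reg.mcrit k + reg.a k * m fl / reg.Zm k) S R R' A B n ≤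
            C' * Real.exp (-(δ' * (reg.a k * n)))) :
    ∃ θ : ℝ, 0 < θ ∧ ∀ (R R' : ℕ) (A : QCDLatticeObservable Nf R) (B : QCDLatticeObservable Nf R'),
      Ch R A → ∃ Φ μ₀ Λ₀ : ℝ, 0 < μ₀ ∧ ∀ (β c lam μ : ℝ) (L : ℕ),
      0 < lam → 0 < μ → μ ≤ μ₀ → Λ₀ ≤ μ * L →
      (∀ S : ℕ, L ≤ S → ∀ (f : Fin Nf) (v : Literature.Probability.LatticeModels.Site 4), v ∈ box 4 S →
        FM β (fun fl => c + lam * m fl) S f v ≤ C * Real.exp (-(μ * ‖v‖))) →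
      ∀ S : ℕ, L ≤ S → ∀ n : ℕ, n ≤ S →
        K β (fun fl => c + lam * m fl) S R R' A B n ≤ Φ * Real.exp (-(θ * μ * n)) := by
  by_contra H
  push Not at H
  choose R R' A B hch hR using H
  -- the bad points `P(j, b)`: rate `θ_j = 1/(j+1)`, block `(Φ, μ₀, Λ₀) = (b, 1/(b+1), b)`
  have hjb : ∀ j b : ℕ, ∃ (β c lam μ : ℝ) (L : ℕ), 0 < lam ∧ 0 < μ ∧ μ ≤ 1 / ((b : ℝ) + 1) ∧
      (b : ℝ) ≤ μ * L ∧
      (∀ S : ℕ, L ≤ S → ∀ (f : Fin Nf) (v : Literature.Probability.LatticeModels.Site 4),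
        v ∈ box 4 S → FM β (fun fl => c + lam * m fl) S f v ≤ C * Real.exp (-(μ * ‖v‖))) ∧
      ∃ S : ℕ, L ≤ S ∧ ∃ n : ℕ, n ≤ S ∧
        (b : ℝ) * Real.exp (-(1 / ((j : ℝ) + 1) * μ * n)) <
          K β (fun fl => c + lam * m fl) S _ _ (A (1 / ((j : ℝ) + 1)) Nat.one_div_pos_of_nat)
            (B (1 / ((j : ℝ) + 1)) Nat.one_div_pos_of_nat) n :=
    fun j b => hR _ _ (b : ℝ) _ (b : ℝ) Nat.one_div_pos_of_nat
  choose β c lam μ L hlam hμ hμle hbL hFM S hLS n hnS hbad using hjb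
  -- ONE regularisation visiting the bad point `((unpair k).1, k)` at step `k`
  obtain ⟨reg, hrega, hregβ, hregL, hregm⟩ : ∃ reg : QCDRegularisation Nf,
      (∀ k, reg.a k = μ (Nat.unpair k).1 k) ∧ (∀ k, reg.β k = β (Nat.unpair k).1 k) ∧
      (∀ k, reg.L k = L (Nat.unpair k).1 k) ∧
      ∀ k, (fun fl => reg.mcrit k + reg.a k * m fl / reg.Zm k) =
        fun fl => c (Nat.unpair k).1 k + lam (Nat.unpair k).1 k * m fl := by
    refine ⟨⟨fun k => μ (Nat.unpair k).1 k, fun k => hμ _ _, ?_, fun k => β (Nat.unpair k).1 k,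
      fun k => L (Nat.unpair k).1 k, ?_, fun k => c (Nat.unpair k).1 k,
      fun k => μ (Nat.unpair k).1 k / lam (Nat.unpair k).1 k, fun k => div_pos (hμ _ _) (hlam _ _)⟩,
      fun _ => rfl, fun _ => rfl, fun _ => rfl, fun k => funext fun fl => ?_⟩
    · -- `0 < a_k ≤ 1/(k+1) → 0`
      exact squeeze_zero (fun k => (hμ _ _).le) (fun k => hμle _ _)
        tendsto_one_div_add_atTop_nhds_zero_nat
    · -- `a_k L_k ≥ k → ∞`
      exact tendsto_atTop_mono (fun k => hbL _ _) tendsto_natCast_atTop_atTop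
    · -- bare masses `c + a_k m / (a_k / λ) = c + λ m`
      show c _ k + μ _ k * m fl / (μ _ k / lam _ k) = _
      rw [div_div_eq_mul_div, mul_assoc, mul_comm (μ _ k), mul_div_assoc, div_self (hμ _ _).ne',
        mul_one, mul_comm]
  -- the crux along `reg`: `Upper` holds with `(s, δ, C) = (s, 1, C)` at EVERY step
  obtain ⟨δ', hδ', hconc⟩ := hcrux reg (Eventually.of_forall fun k S hS f v hv => by
    rw [hregm k, hregβ k, hrega k, one_mul]
    exact hFM _ k S (hregL k ▸ hS) f v hv)
  -- the elementary monotone transfer `C' e^{-δ' (a n)} ≤ t e^{-θ' a n}` (`θ' ≤ δ'`, `C' ≤ t`, `0 ≤ a`)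
  have htr : ∀ (θ' a' C' : ℝ) (t n' : ℕ), θ' ≤ δ' → 0 ≤ a' → C' ≤ t →
      C' * Real.exp (-(δ' * (a' * n'))) ≤ t * Real.exp (-(θ' * a' * n')) := by
    intro θ' a' C' t n' hθ' ha' hC'
    have hn' : 0 ≤ a' * (n' : ℝ) := mul_nonneg ha' (Nat.cast_nonneg _)
    calc C' * Real.exp (-(δ' * (a' * n'))) ≤ t * Real.exp (-(δ' * (a' * n'))) :=
        mul_le_mul_of_nonneg_right hC' (Real.exp_nonneg _)
      _ ≤ t * Real.exp (-(θ' * a' * n')) :=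
        mul_le_mul_of_nonneg_left
          (Real.exp_le_exp.2 (by nlinarith [mul_le_mul_of_nonneg_right hθ' hn']))
          (Nat.cast_nonneg _)
  -- `θ_{j₀} = 1/(j₀+1) < δ'`, the crux's constant `C'` for the pair chosen at `θ_{j₀}`, from step `k₀` on
  obtain ⟨j₀, hj₀⟩ := exists_nat_one_div_lt hδ'
  obtain ⟨C', hC'⟩ := hconc _ _ (A (1 / ((j₀ : ℝ) + 1)) Nat.one_div_pos_of_nat)
    (B (1 / ((j₀ : ℝ) + 1)) Nat.one_div_pos_of_nat) (hch _ _)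
  obtain ⟨k₀, hk₀⟩ := eventually_atTop.1 hC'
  obtain ⟨N, hN⟩ := exists_nat_gt C'
  -- a late step on the fibre `(unpair k).1 = j₀` with block parameter `k > C'`
  obtain ⟨k, hk₁, hk₂, hjk⟩ : ∃ k : ℕ, k₀ ≤ k ∧ N ≤ k ∧ (Nat.unpair k).1 = j₀ :=
    ⟨Nat.pair j₀ (max k₀ N), (le_max_left _ _).trans (Nat.right_le_pair _ _),
      (le_max_right _ _).trans (Nat.right_le_pair _ _), by rw [Nat.unpair_pair]⟩
  subst hjk
  have hgood := hk₀ k hk₁ (S _ k) ((hregL k).symm ▸ hLS _ k) (n _ k) (hnS _ k)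
  rw [hregβ k, hregm k, hrega k] at hgood
  have hNk : (N : ℝ) ≤ k := by exact_mod_cast hk₂
  exact (hbad _ k).not_ge (hgood.trans (htr _ _ _ _ _ hj₀.le (hμ _ _).le (by linarith)))

/-! ### The registered stub -/

/-- **W5 (registered stub `stub_uniformPencil_of_crux`).** The crux `PhaseQuenchedFlavourDecay`
(hypothesis) implies its reg-free UNIFORM pencil form: for renormalised masses `m > 0` and
Fredenhagen–Marcu data `(s, C)` there is a rate `θ(s, C, m) > 0` and, for every flavour-charged pair of
local observables `(A, B)`, constants `Φ, μ₀ > 0, Λ₀` such that at EVERY lattice parameter point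
`(β, c, λ > 0)` with bare masses `c + λ m`, every rate `0 < μ ≤ μ₀` and every `L` with `Λ₀ ≤ μ L`,
Fredenhagen–Marcu decay `FM ≤ C e^{-μ |v|}` on the volumes `S ≥ L` gives the phase-quenched clustering
`|⟨A(0) B(n e₀)⟩| ≤ Φ e^{-θ μ n}` (`n ≤ S`) on those volumes.  `uniformPencilConc_diagonal` with the concrete
`FM`, charge predicate and correlator modulus, and the crux at `Upper`-data `(s, 1, C)`. -/
theorem stub_uniformPencil_of_crux :
    Summit.QuantumFields.QCD.Theses.PauliWegnerSea.PhaseQuenchedFlavourDecay → ∀ (Nf : ℕ) (m : Fin Nf → ℝ), (∀ f, 0 < m f) → ∀ (s C : ℝ), 0 < s → s < 1 → ∃ θ : ℝ, 0 < θ ∧ ∀ (R R' : ℕ) (A : QCDLatticeObservable Nf R) (B : QCDLatticeObservable Nf R'), (∃ (f₀ : Fin Nf) (q : ℤ), q ≠ 0 ∧ ∀ (θ : ℝ) (U : LGConfig 4 (Matrix.specialUnitaryGroup (Fin 3) ℂ)), ExteriorAlgebra.map (LinearMap.pi fun w => (Sum.elim (fun i => if (boxQuarkEquiv.symm i).1 =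 f₀ then Complex.exp (-((θ : ℂ) * Complex.I)) else 1) (fun i => if (boxQuarkEquiv.symm i).1 = f₀ then Complex.exp ((θ : ℂ) * Complex.I) else 1) (ofLex w)) • LinearMap.proj w) (A.F U) = Complex.exp (((q : ℝ) * θ : ℝ) * Complex.I) • A.F U) → ∃ Φ μ₀ Λ₀ : ℝ, 0 < μ₀ ∧ ∀ (β c lam μ : ℝ) (L : ℕ), 0 < lam → 0 < μ → μ ≤ μ₀ → Λ₀ ≤ μ * L → (∀ S : ℕ, L ≤ S → ∀ (f : Fin Nf) (v : Literature.Probability.LatticeModels.Site 4), v ∈ box 4 S → (∫ U : GaugeConfig 4 (2 * S + 1) (Matrix.specialUnitaryGroup (Fin 3) ℂ), ‖(diracMatrix U fun fl => c + lam * m fl).det‖ * (∑ a : Fin 3, ∑ i : Fin 4, ∑ b : Fin 3, ∑ j : Fin 4, ‖(diracMatrix U fun fl => c + lam * m fl)⁻¹ (quarkEquiv (f, (Torus.proj (2 * S + 1) 0, a, i))) (quarkEquiv (f, (Torus.proj (2 * S + 1) (v), b, j)))‖) ^ s ∂(wilsonMeasure (fundamentalRep (Fin 3)) β)) / (∫ U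 : GaugeConfig 4 (2 * S + 1) (Matrix.specialUnitaryGroup (Fin 3) ℂ), ‖(diracMatrix U fun fl => c + lam * m fl).det‖ ∂(wilsonMeasure (fundamentalRep (Fin 3)) β)) ≤ C * Real.exp (-(μ * ‖v‖))) → ∀ S : ℕ, L ≤ S → ∀ n : ℕ, n ≤ S → ‖(∫ U : GaugeConfig 4 (2 * S + 1) (Matrix.specialUnitaryGroup (Fin 3) ℂ), (‖(diracMatrix U fun fl => c + lam * m fl).det‖ : ℂ) * (fermiIntegral (A.onTorus (2 * S + 1) 0 U * B.onTorus (2 * S + 1) (Pi.single 0 (n : ℤ)) U * fermiBoltzmann U fun fl => c + lam * m fl) / fermiIntegral (fermiBoltzmann U fun fl => c + lam * m fl)) ∂(wilsonMeasure (fundamentalRep (Fin 3)) β)) / (∫ U : GaugeConfig 4 (2 * S + 1) (Matrix.specialUnitaryGroup (Fin 3) ℂ), (‖(diracMatrix U fun fl => c + lam * m fl).det‖ : ℂ) ∂(wilsonMeasure (fundamentalRep (Fin 3)) β))‖ ≤ Φ * Real.exp (-(θ * μ * n)) := by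
  intro hcrux Nf m hm s C hs hs1
  exact uniformPencilConc_diagonal m
    (fun β mq S f v => (∫ U : GaugeConfig 4 (2 * S + 1) (Matrix.specialUnitaryGroup (Fin 3) ℂ),
        ‖(diracMatrix U mq).det‖ * (∑ a : Fin 3, ∑ i : Fin 4, ∑ b : Fin 3, ∑ j : Fin 4,
          ‖(diracMatrix U mq)⁻¹ (quarkEquiv (f, (Torus.proj (2 * S + 1) 0, a, i)))
            (quarkEquiv (f, (Torus.proj (2 * S + 1) (v), b, j)))‖) ^ s
              ∂(wilsonMeasure (fundamentalRep (Fin 3)) β)) /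
      (∫ U : GaugeConfig 4 (2 * S + 1) (Matrix.specialUnitaryGroup (Fin 3) ℂ),
        ‖(diracMatrix U mq).det‖ ∂(wilsonMeasure (fundamentalRep (Fin 3)) β)))
    (fun R A => ∃ (f₀ : Fin Nf) (q : ℤ), q ≠ 0 ∧
      ∀ (θ : ℝ) (U : LGConfig 4 (Matrix.specialUnitaryGroup (Fin 3) ℂ)),
        ExteriorAlgebra.map (LinearMap.pi fun w => (Sum.elim
          (fun i => if (boxQuarkEquiv.symm i).1 = f₀ then Complex.exp (-((θ : ℂ) * Complex.I)) else 1)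
          (fun i => if (boxQuarkEquiv.symm i).1 = f₀ then Complex.exp ((θ : ℂ) * Complex.I) else 1)
          (ofLex w)) • LinearMap.proj w) (A.F U) = Complex.exp (((q : ℝ) * θ : ℝ) * Complex.I) • A.F U)
    (fun β mq S R R' A B n => ‖(∫ U : GaugeConfig 4 (2 * S + 1) (Matrix.specialUnitaryGroup (Fin 3) ℂ),
        (‖(diracMatrix U mq).det‖ : ℂ) * (fermiIntegral (A.onTorus (2 * S + 1) 0 U *
          B.onTorus (2 * S + 1) (Pi.single 0 (n : ℤ)) U * fermiBoltzmann U mq) /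
            fermiIntegral (fermiBoltzmann U mq)) ∂(wilsonMeasure (fundamentalRep (Fin 3)) β)) /
      (∫ U : GaugeConfig 4 (2 * S + 1) (Matrix.specialUnitaryGroup (Fin 3) ℂ),
        (‖(diracMatrix U mq).det‖ : ℂ) ∂(wilsonMeasure (fundamentalRep (Fin 3)) β))‖)
    C
    (fun reg hup => hcrux Nf reg m hm ⟨s, 1, C, hs, hs1, one_pos, hup⟩)

end Summit.QuantumFields.QCD.Cruxes.PhaseQuenchedFlavourDecay.CrossingSplitIntegrability
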